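import Literature.NumberTheory.Automorphic.UnitOrbitalIntegralSplitTorusHSide      -- ★ (L8b)-H: brings the torus-descent kit at `N = 2`, ★ C2, canonical families, transport
import Literature.NumberTheory.Automorphic.ConstantTermIwahoriAverage              -- ★ PART A (F0P3a-p04): the `K`-averaged Iwahori unit at a torus element
import Literature.NumberTheory.Automorphic.CMPrincipalSeriesSpherical              -- ★ `mem_cmLocalIntegralLevel_iff_forall_v_le_one`, `v_apply_le_one_of_mem_cmLocalIntegralLevel`
import Literature.NumberTheory.Automorphic.IwahoriGLTwoVertexStabilizers           -- ★ (B-p10, ED. 2): `iwahoriGL` on the one-place model, `K ⊓ K′ = I`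
import HarnessLib

/-!
# The IWAHORI unit orbital integral of `U(Φ₂)(L⁺_v)` at a regular split-torus class: `ν(I)⁻¹ Φ(⟦γ⟧, 1_I) = 2 · ν(K)⁻¹ Φ(⟦γ⟧, 1_K)`
(Kottwitz (1988) §2: the Euler–Poincaré function `ν(K)⁻¹1_K + ν(K′)⁻¹1_{K′} − ν(I)⁻¹1_I` on the tree of the rank-one group `U(Φ₂)_v` has
vanishing hyperbolic orbital integrals; Rogawski (1990) §12.6 p. 174 (pseudo-coefficients), §4.9 (4.9.2) p. 55; Gelbart (1975) Thm. 9.22 (iii))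

Topic `NumberTheory/Automorphic`; namespace `Literature.NumberTheory.Automorphic.UnitaryGroup`.  KERNEL mathematics only: theorems, no definition,
no named fact, no instance, no notation, no `sorry`.  Cell `pub/hodgecm-mathlib`, crux H413 = `stmt-HodgeConjecture-24833`, line «N6nsGerm», stub
`stub_N6nsR2EP : RankOneEulerPoincareNonsplit` ((R2)); EP pen B-p04 (g34) (census `B-provers/B-p04/g34/CENSUS-R2EP-RankOneEulerPoincare.B-p04g34.md`),
brick (ii) «the Iwahori unit at a split-torus regular class» (B-p10 (g25) «=» 08:29Z; glue ★ B-p14 `RankOneEulerPoincareGlue` binder `hN`); seat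
F0P3a-p04 (g13).  HONEST LABEL: HC_CM is proved only modulo the printed citations until rung 0 closes; nothing printed is asserted here.

THE MATHEMATICS.  `U₂ = U(Φ₂)(L⁺_v)` at a finite place `v` of `L⁺` (`w ∣ v`, `c • w = w`), `K = K_v` the hyperspecial level (★ `cmLocalIntegralLevel`), `I ≤ K`
ANY open subgroup with the UPPER-IWAHORI membership criterion `u ∈ I ↔ u ∈ K ∧ |(u_w)₁₀|_w < 1` (binder `hI`; e.g. `I = K ⊓ K′` with `K′` the
`ϖ`-modular vertex stabiliser of B-p10's similitude dictionary), `m` a CANONICAL orbital-measure family for `(IsRegularElt, ν)`.  For a REGULAR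
DIAGONAL `γ = diag(d₀, d₁)` (`d₀⁻¹d₁ − 1` a unit):
**`((ν I).toReal)⁻¹ · Φ(⟦γ⟧, 1_I; m) = 2 · ((ν K).toReal)⁻¹ · Φ(⟦γ⟧, 1_K; m)`** (`ℂ`-valued units, the glue's currency).
Proof: both sides are read against the SAME canonical member `ν∕t_Z` (★ `IsCanonical.classOrbitalIntegral_mk_eq_orbitalIntegral'`), transported to
`U(Φ₂) ⧸ T₂` (★ `lintegral_descConj_quotientMeasure_eq_of_mulEquiv`, `Z(γ) = T₂` ★ `mem_torusU_iff_mem_centralizer_of_isUnit_sub`), unfolded in Iwasawa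
coordinates (★ `exists_measure_quotient_torusU_cmLocal_two_eq_smul_map` + ★ `lintegral_descConj_torusU_cmLocal_two_regular_eq_mul_lintegral_prod`:
`= C·J_H(γ)·∫_{K×N₂} F(k (γ n) k⁻¹)`) — the Iwasawa constant `C` and the twist module `J_H(γ)` are COMMON to both sides and cancel; the two
`K × N₂` integrals are ★ A-p06 `lintegral_prod_indicator_conj_levi_mul_unipotent` (`κ(K)·μ_N(N₂ ∩ K)·1_K(γ)`) and ★ PART A
`lintegral_prod_indicator_iwahori_conj_torus_mul_unipotent` (`2·κ(I)·μ_N(N₂ ∩ K)·1_K(γ)`), whose «rank-one Iwahori position» hypotheses are discharged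
here (§1: the ring-generic Bruhat step `k = i·Φ₂·n(k₁₀⁻¹k₁₁)` for `k₁₀` a unit, from the ROW unitarity relation `k₁₀σ(k₁₁) + k₁₁σ(k₁₀) = 0`; §2: at
`v`, `k ∈ K ∖ I` has `|k₁₀|_w = 1`); finally `ν(K)·κ(I) = ν(I)·κ(K)` (both `= [K:I]·…`, ★ `measure_subgroup_eq_relIndex_mul_of_isCompact`).
With B-p10's similitude transport (`Φ(1_{K′})(γ)∕ν(K′) = Φ(1_K)(γ)∕ν(K)` at diagonal `γ`) this is the glue's relation (N) by `ring`.
NOT here: `K′`, the similitude transport, the non-diagonal split classes (conjugation invariance, B-p14 (g-D)), the elliptic relation (E).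

## References
* [Kottwitz1988] R. E. Kottwitz, *Tamagawa numbers*, Ann. of Math. 127 (1988), §2 Theorem 2.
* [Rogawski1990] J. D. Rogawski, *Automorphic Representations of Unitary Groups in Three Variables*, Ann. of Math. Stud. 123 (1990), §12.6 p. 174;
  §4.9 (4.9.2) p. 55; §4.13 p. 70; §1.10 p. 9.
* [Gelbart1975] S. Gelbart, *Automorphic Forms on Adele Groups*, Ann. of Math. Stud. 83 (1975), Thm. 9.22 (iii).
* [CartierCorvallis1979] P. Cartier, *Representations of 𝔭-adic groups: a survey*, PSPM 33.1 (1979), §III.5, §IV (4.2).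
-/

set_option autoImplicit false

noncomputable section

open MeasureTheory Measure Set Filter Topology NumberField IsDedekindDomain
open Literature.MeasureTheory.Group
open scoped ENNReal NNReal Matrix MatrixGroups

namespace Literature.NumberTheory.Automorphic.UnitaryGroup

open Literature.NumberTheory.Rogawski1990 (IsRegularElt)
open Literature.NumberTheory.Automorphic
open Literature.NumberTheory.Automorphic.UnitaryGroup.HeisRing Literature.NumberTheory.Automorphic.UnitaryGroup.LineRing

/-! ## §1 Ring-generic: the rank-one Bruhat step in `U(σ, Φ₂)(R)` -/

section Algebra

variable {R : Type*} [CommRing R] (σ : R →+* R) {J : Matrix (Fin 2) (Fin 2) R} (hJ : J = (StdForm.antidiagonal 2).over R)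

omit σ in
/-- The entries of `Φ₂ = antidiag(1, 1)` over `R`. [cite: Rogawski1990, §1.10 p. 9] -/
theorem antidiagonal_over_two_apply :
    (StdForm.antidiagonal 2).over R 0 0 = 0 ∧ (StdForm.antidiagonal 2).over R 0 1 = 1 ∧
      (StdForm.antidiagonal 2).over R 1 0 = 1 ∧ (StdForm.antidiagonal 2).over R 1 1 = 0 := by
  refine ⟨?_, ?_, ?_, ?_⟩ <;>
    simp [StdForm.over, StdForm.antidiagonal, Matrix.map_apply, Matrix.of_apply, Fin.rev, Fin.ext_iff]

include hJ in
/-- **The ROW unitarity relation of `U(σ, Φ₂)(R)` at `(1, 1)`**: `g₁₀ σ(g₁₁) + g₁₁ σ(g₁₀) = 0` — from `g Φ₂ (σg)ᵀ = Φ₂`, which follows from the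
defining COLUMN relation `(σg)ᵀ Φ₂ g = Φ₂` since a one-sided inverse of a square matrix is two-sided (Mathlib `mul_eq_one_comm`).
[cite: Rogawski1990, §1.10 p. 9] -/
theorem row_one_one_relation_two (g : ↥(unitaryGroupOfForm σ J)) :
    ((g : GL (Fin 2) R) : Matrix (Fin 2) (Fin 2) R) 1 0 * σ (((g : GL (Fin 2) R) : Matrix (Fin 2) (Fin 2) R) 1 1) +
      ((g : GL (Fin 2) R) : Matrix (Fin 2) (Fin 2) R) 1 1 * σ (((g : GL (Fin 2) R) : Matrix (Fin 2) (Fin 2) R) 1 0) = 0 := by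
  set X : Matrix (Fin 2) (Fin 2) R := ((g : GL (Fin 2) R) : Matrix (Fin 2) (Fin 2) R) with hX
  have hg : (X.map σ)ᵀ * J * X = J := g.2
  have hJJ : J * J = 1 := by rw [hJ]; exact StdForm.over_mul_over _ R
  -- `(J (σX)ᵀ J) X = 1`, hence `X (J (σX)ᵀ J) = 1`, hence `X J (σX)ᵀ = J`
  have h1 : (J * ((X.map σ)ᵀ * J)) * X = 1 := by
    rw [Matrix.mul_assoc, Matrix.mul_assoc, ← Matrix.mul_assoc (X.map σ)ᵀ, hg, hJJ]
  have h2 : X * (J * ((X.map σ)ᵀ * J)) = 1 := mul_eq_one_comm.1 h1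
  have h3 : X * J * (X.map σ)ᵀ = J := by
    have h := congrArg (· * J) h2
    simp only [Matrix.mul_assoc, hJJ, Matrix.mul_one, Matrix.one_mul] at h
    simpa only [Matrix.mul_assoc] using h
  have h4 := congrArg (fun M : Matrix (Fin 2) (Fin 2) R => M 1 1) h3
  simp only [Matrix.mul_apply, Fin.sum_univ_two, Matrix.transpose_apply, Matrix.map_apply, hJ,
    antidiagonal_over_two_apply.1, antidiagonal_over_two_apply.2.1, antidiagonal_over_two_apply.2.2.1,
    antidiagonal_over_two_apply.2.2.2, mul_zero, mul_one, zero_add, add_zero] at h4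
  linear_combination h4

include hJ in
/-- **THE RANK-ONE BRUHAT STEP in `U(σ, Φ₂)(R)`**: if `k ∈ U(σ, Φ₂)(R)` has `k₁₀` a UNIT, then with `y := k₁₀⁻¹ k₁₁` (which is `σ`-skew by the row
relation) the unipotent `x = n(y) ∈ N₂` (★ `exists_lineChart`) satisfies `(k x⁻¹ w₀⁻¹)₁₀ = 0` for any `w₀ ∈ U` with matrix `Φ₂` — i.e. `k = i · w₀ · x` with
`i` upper triangular.  Any topological commutative ring (used over `R = ∏_{w∣v} L_w`). [cite: CartierCorvallis1979, §III.5] [cite: Rogawski1990, §1.10 p. 9] -/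
theorem exists_unipotent_bruhat_two [TopologicalSpace R] [IsTopologicalRing R] (k w₀ : ↥(unitaryGroupOfForm σ J))
    (hw₀ : ((w₀ : GL (Fin 2) R) : Matrix (Fin 2) (Fin 2) R) = J)
    (u : Rˣ) (hu : (u : R) = ((k : GL (Fin 2) R) : Matrix (Fin 2) (Fin 2) R) 1 0) :
    ∃ x : ↥(unipotentU σ J),
      (((x : ↥(unitaryGroupOfForm σ J)) : GL (Fin 2) R) : Matrix (Fin 2) (Fin 2) R) 0 1 =
          ((u⁻¹ : Rˣ) : R) * ((k : GL (Fin 2) R) : Matrix (Fin 2) (Fin 2) R) 1 1 ∧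
        (((k * (x : ↥(unitaryGroupOfForm σ J))⁻¹ * w₀⁻¹ : ↥(unitaryGroupOfForm σ J)) : GL (Fin 2) R) : Matrix (Fin 2) (Fin 2) R) 1 0 = 0 := by
  -- `σ y = -y` for `y := u⁻¹ k₁₁`, from the row relation `k₁₀ σ(k₁₁) + k₁₁ σ(k₁₀) = 0`
  have hrow : (u : R) * σ (((k : GL (Fin 2) R) : Matrix (Fin 2) (Fin 2) R) 1 1) +
      ((k : GL (Fin 2) R) : Matrix (Fin 2) (Fin 2) R) 1 1 * σ (u : R) = 0 := by
    rw [hu]; exact row_one_one_relation_two σ hJ k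
  have hinv : σ ((u⁻¹ : Rˣ) : R) * σ (u : R) = 1 := by rw [← map_mul, Units.inv_mul, map_one]
  have hinv' : ((u⁻¹ : Rˣ) : R) * (u : R) = 1 := Units.inv_mul u
  have hyskew : σ (((u⁻¹ : Rˣ) : R) * ((k : GL (Fin 2) R) : Matrix (Fin 2) (Fin 2) R) 1 1) =
      -(((u⁻¹ : Rˣ) : R) * ((k : GL (Fin 2) R) : Matrix (Fin 2) (Fin 2) R) 1 1) := by
    have key : σ (u : R) * (u : R) * (σ (((u⁻¹ : Rˣ) : R) * ((k : GL (Fin 2) R) : Matrix (Fin 2) (Fin 2) R) 1 1) +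
        ((u⁻¹ : Rˣ) : R) * ((k : GL (Fin 2) R) : Matrix (Fin 2) (Fin 2) R) 1 1) = 0 := by
      rw [map_mul]
      linear_combination ((u : R) * σ (((k : GL (Fin 2) R) : Matrix (Fin 2) (Fin 2) R) 1 1)) * hinv +
        (σ (u : R) * ((k : GL (Fin 2) R) : Matrix (Fin 2) (Fin 2) R) 1 1) * hinv' + hrow
    have h0 := ((u.isUnit.map σ).mul u.isUnit).mul_right_eq_zero.1 key
    linear_combination h0
  -- the unipotent `x = n(y)` from the line chart
  obtain ⟨e, he, -⟩ := exists_lineChart σ hJ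
  refine ⟨e ⟨_, (mem_skewPart_iff σ _).2 hyskew⟩, he _, ?_⟩
  set x : ↥(unipotentU σ J) := e ⟨_, (mem_skewPart_iff σ _).2 hyskew⟩ with hxdef
  have hx01 : (((x : ↥(unitaryGroupOfForm σ J)) : GL (Fin 2) R) : Matrix (Fin 2) (Fin 2) R) 0 1 =
      ((u⁻¹ : Rˣ) : R) * ((k : GL (Fin 2) R) : Matrix (Fin 2) (Fin 2) R) 1 1 := he _
  -- the matrices of `x⁻¹` and `w₀⁻¹`
  obtain ⟨hxi10, hxi00, hxi11⟩ := umat_shape_two σ x⁻¹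
  have hxi01 := umat_inv_zero_one_two σ x
  rw [hx01] at hxi01
  have hxi : ((x : ↥(unitaryGroupOfForm σ J))⁻¹ : ↥(unitaryGroupOfForm σ J)) = ((x⁻¹ : ↥(unipotentU σ J)) : ↥(unitaryGroupOfForm σ J)) := rfl
  have hJJ : J * J = 1 := by rw [hJ]; exact StdForm.over_mul_over _ R
  have hJ00 : J 0 0 = 0 := by rw [hJ]; exact antidiagonal_over_two_apply.1
  have hJ10 : J 1 0 = 1 := by rw [hJ]; exact antidiagonal_over_two_apply.2.2.1
  have hwi : (((w₀⁻¹ : ↥(unitaryGroupOfForm σ J)) : GL (Fin 2) R) : Matrix (Fin 2) (Fin 2) R) = J := by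
    rw [Subgroup.coe_inv, Matrix.coe_units_inv, hw₀]
    exact Matrix.inv_eq_left_inv hJJ
  rw [Subgroup.coe_mul, Subgroup.coe_mul, Units.val_mul, Units.val_mul, hwi, hxi, Matrix.mul_apply, Fin.sum_univ_two,
    Matrix.mul_apply, Matrix.mul_apply, Fin.sum_univ_two, Fin.sum_univ_two, hxi10, hxi00, hxi11, hxi01, hJ00, hJ10, ← hu]
  linear_combination (-(((k : GL (Fin 2) R) : Matrix (Fin 2) (Fin 2) R) 1 1)) * hinv'

end Algebra

/-! ## §2 The CM carrier `U₂ = U(Φ₂)(L⁺_v)`: rank-one Iwahori position and the ratio of the two units -/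

section CM

variable (L : Type) [Field L] [NumberField L] [IsCMField L] {v : HeightOneSpectrum (𝓞 ↥(maximalRealSubfield L))}

/-- **`Φ₂ ∈ U(Φ₂)(L⁺_v)` as an element** (the Weyl representative `w₀`): `Φ₂` is `σ`-fixed, symmetric and an involution, so `ᵗ(σΦ₂)·Φ₂·Φ₂ = Φ₂`; its matrix and
that of its inverse are `Φ₂`. [cite: Rogawski1990, §1.10 p. 9] -/
theorem exists_weylElement_two (v : HeightOneSpectrum (𝓞 ↥(maximalRealSubfield L))) :
    ∃ w₀ : ↥(unitaryGroupOfForm (conjLocal L (IsCMField.complexConj L) v) (cmLocalForm L 2 v)),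
      (w₀ : GL (Fin 2) (LocalRing L v)).val = cmLocalForm L 2 v ∧
        ((w₀⁻¹ : ↥(unitaryGroupOfForm (conjLocal L (IsCMField.complexConj L) v) (cmLocalForm L 2 v))) : GL (Fin 2) (LocalRing L v)).val =
          cmLocalForm L 2 v := by
  have hJ := cmLocalForm_eq_over L 2 v
  have hJJ : cmLocalForm L 2 v * cmLocalForm L 2 v = 1 := by rw [hJ]; exact StdForm.over_mul_over _ _
  have hmem : (⟨cmLocalForm L 2 v, cmLocalForm L 2 v, hJJ, hJJ⟩ : GL (Fin 2) (LocalRing L v)) ∈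
      unitaryGroupOfForm (conjLocal L (IsCMField.complexConj L) v) (cmLocalForm L 2 v) := by
    rw [mem_unitaryGroupOfForm_iff]
    change ((cmLocalForm L 2 v).map (conjLocal L (IsCMField.complexConj L) v))ᵀ * cmLocalForm L 2 v * cmLocalForm L 2 v = cmLocalForm L 2 v
    rw [hJ, StdForm.over_map, StdForm.transpose_over, StdForm.over_mul_over, Matrix.one_mul]
  refine ⟨⟨_, hmem⟩, rfl, ?_⟩
  rw [Subgroup.coe_inv, Matrix.coe_units_inv]
  exact Matrix.inv_eq_left_inv hJJ

set_option maxHeartbeats 1600000 in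
set_option synthInstance.maxHeartbeats 400000 in
-- instance-term unification on the CM local carrier (two spellings of `U(Φ₂)(L⁺_v)`), as in ★ `UnitOrbitalIntegralSplitTorusHSide`
/-- **THE IWAHORI UNIT AGAINST THE HYPERSPECIAL UNIT AT A REGULAR SPLIT-TORUS CLASS of `U₂ = U(Φ₂)(L⁺_v)`** (the non-elliptic input (N) of Kottwitz's
Euler–Poincaré function, up to B-p10's similitude transport): at a finite place `v` of `L⁺` with `w ∣ v`, `c • w = w`, for a CANONICAL family `m` (for
`IsRegularElt` and the Haar measure `ν`), ANY open subgroup `I` with the upper-Iwahori criterion `u ∈ I ↔ u ∈ K_v ∧ |(u₁₀)_w|_w < 1`, and a REGULAR DIAGONAL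
`γ = diag(d₀, d₁)` (`d₀⁻¹d₁ − 1` a unit):
**`((ν I).toReal)⁻¹ · Φ(⟦γ⟧, 1_I; m) = 2 · ((ν K_v).toReal)⁻¹ · Φ(⟦γ⟧, 1_{K_v}; m)`**.
[cite: Kottwitz1988, §2 Theorem 2] [cite: Rogawski1990, §12.6 p. 174; §4.9 (4.9.2) p. 55] [cite: Gelbart1975, Thm. 9.22 (iii)] -/
theorem inv_measure_mul_classOrbitalIntegral_iwahori_eq_two_mul_of_torus_regular
    (w : PlacesOver L v) (hw : IsCMField.complexConj L • w.1 = w.1)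
    [MeasurableSpace ((cmDatum L 2 (Matrix.of fun i j : Fin 2 => if i.val + j.val + 1 = 2 then (1 : L) else 0)).Local v)] [BorelSpace ((cmDatum L 2 (Matrix.of fun i j : Fin 2 => if i.val + j.val + 1 = 2 then (1 : L) else 0)).Local v)]
    [∀ a : (cmDatum L 2 (Matrix.of fun i j : Fin 2 => if i.val + j.val + 1 = 2 then (1 : L) else 0)).Local v, MeasurableSpace (((cmDatum L 2 (Matrix.of fun i j : Fin 2 => if i.val + j.val + 1 = 2 then (1 : L) else 0)).Local v) ⧸ Subgroup.centralizer ({a} : Set ((cmDatum L 2 (Matrix.of fun i j : Fin 2 => if i.val + j.val + 1 = 2 then (1 : L) else 0)).Local v)))]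
    [∀ a : (cmDatum L 2 (Matrix.of fun i j : Fin 2 => if i.val + j.val + 1 = 2 then (1 : L) else 0)).Local v, BorelSpace (((cmDatum L 2 (Matrix.of fun i j : Fin 2 => if i.val + j.val + 1 = 2 then (1 : L) else 0)).Local v) ⧸ Subgroup.centralizer ({a} : Set ((cmDatum L 2 (Matrix.of fun i j : Fin 2 => if i.val + j.val + 1 = 2 then (1 : L) else 0)).Local v)))]
    (ν : Measure ((cmDatum L 2 (Matrix.of fun i j : Fin 2 => if i.val + j.val + 1 = 2 then (1 : L) else 0)).Local v)) [ν.IsHaarMeasure] [ν.IsMulRightInvariant]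
    {m : OrbitalMeasureFamily ((cmDatum L 2 (Matrix.of fun i j : Fin 2 => if i.val + j.val + 1 = 2 then (1 : L) else 0)).Local v)}
    (hm : m.IsCanonical (fun γ => IsRegularElt (γ.val : GL (Fin 2) (LocalRing L v))) ν)
    (I : Subgroup ((cmDatum L 2 (Matrix.of fun i j : Fin 2 => if i.val + j.val + 1 = 2 then (1 : L) else 0)).Local v)) (hIo : IsOpen (I : Set ((cmDatum L 2 (Matrix.of fun i j : Fin 2 => if i.val + j.val + 1 = 2 then (1 : L) else 0)).Local v)))
    (hI : ∀ u : (cmDatum L 2 (Matrix.of fun i j : Fin 2 => if i.val + j.val + 1 = 2 then (1 : L) else 0)).Local v, u ∈ I ↔ u ∈ cmLocalIntegralLevel L 2 (Matrix.of fun i j : Fin 2 => if i.val + j.val + 1 = 2 then (1 : L) else 0) v ∧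
      Valued.v (((u.val : GL (Fin 2) (LocalRing L v)).val 1 0) w) < 1)
    {γ : (cmDatum L 2 (Matrix.of fun i j : Fin 2 => if i.val + j.val + 1 = 2 then (1 : L) else 0)).Local v} (hreg : IsRegularElt (γ.val : GL (Fin 2) (LocalRing L v)))
    {d : Fin 2 → (LocalRing L v)ˣ} (hd : glDiagonal 2 (LocalRing L v) d = (γ.val : GL (Fin 2) (LocalRing L v)))
    (hb : IsUnit ((((d 0)⁻¹ * d 1 : (LocalRing L v)ˣ) : LocalRing L v) - 1)) :
    (((ν I).toReal : ℂ))⁻¹ * classOrbitalIntegral m ((I : Set ((cmDatum L 2 (Matrix.of fun i j : Fin 2 => if i.val + j.val + 1 = 2 then (1 : L) else 0)).Local v)).indicator fun _ => (1 : ℂ)) (ConjClasses.mk γ) =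
      2 * (((ν (cmLocalIntegralLevel L 2 (Matrix.of fun i j : Fin 2 => if i.val + j.val + 1 = 2 then (1 : L) else 0) v)).toReal : ℂ))⁻¹ *
        classOrbitalIntegral m ((cmLocalIntegralLevel L 2 (Matrix.of fun i j : Fin 2 => if i.val + j.val + 1 = 2 then (1 : L) else 0) v : Set ((cmDatum L 2 (Matrix.of fun i j : Fin 2 => if i.val + j.val + 1 = 2 then (1 : L) else 0)).Local v)).indicator fun _ => (1 : ℂ)) (ConjClasses.mk γ) := by
  have hc := IsCMField.complexConj_ne_one L
  haveI : Algebra.IsQuadraticExtension ↥(maximalRealSubfield L) L := IsCMField.isQuadraticExtension L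
  haveI : Subsingleton (PlacesOver L v) := PlacesOver.subsingleton_of_smul_eq (IsCMField.complexConj L) hc w hw
  have hJ := cmLocalForm_eq_over L 2 v
  have hΦ₂ := antidiagOne_map_transpose (IsCMField.complexConj L) 2
  have hΦ₂d : IsUnit (Matrix.of fun i j : Fin 2 => if i.val + j.val + 1 = 2 then (1 : L) else 0).det := by
    have h : (Matrix.of fun i j : Fin 2 => if i.val + j.val + 1 = 2 then (1 : L) else 0) = !![0, 1; 1, 0] := by
      ext i j; fin_cases i <;> fin_cases j <;> rfl
    rw [h, Matrix.det_fin_two_of]; norm_num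
  -- regularity of `diag(d)` in the all-pairs form
  have h10 : IsUnit ((d 1 : LocalRing L v) - d 0) := by
    have h := (d 0).isUnit.mul hb
    rwa [mul_sub, mul_one, Units.val_mul, Units.mul_inv_cancel_left] at h
  have hregd : ∀ i j : Fin 2, i ≠ j → IsUnit ((d i : LocalRing L v) - d j) := by
    intro i j hij
    fin_cases i <;> fin_cases j
    · exact absurd rfl hij
    · simpa using h10.neg
    · exact h10
    · exact absurd rfl hij
  have hKco := isCompact_isOpen_cmLocalIntegralLevel L 2 (Matrix.of fun i j : Fin 2 => if i.val + j.val + 1 = 2 then (1 : L) else 0) v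
  have hIK : I ≤ cmLocalIntegralLevel L 2 (Matrix.of fun i j : Fin 2 => if i.val + j.val + 1 = 2 then (1 : L) else 0) v := fun u hu => ((hI u).1 hu).1
  -- Step 1: the canonical torus measure on `Z(γ)`; both class orbital integrals as `lintegral`s against `ν∕t_Z`
  letI : MeasurableSpace («local» L (IsCMField.complexConj L) 2 (Matrix.of fun i j : Fin 2 => if i.val + j.val + 1 = 2 then (1 : L) else 0) v) :=
    ‹MeasurableSpace ((cmDatum L 2 (Matrix.of fun i j : Fin 2 => if i.val + j.val + 1 = 2 then (1 : L) else 0)).Local v)›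
  haveI : BorelSpace («local» L (IsCMField.complexConj L) 2 (Matrix.of fun i j : Fin 2 => if i.val + j.val + 1 = 2 then (1 : L) else 0) v) :=
    ‹BorelSpace ((cmDatum L 2 (Matrix.of fun i j : Fin 2 => if i.val + j.val + 1 = 2 then (1 : L) else 0)).Local v)›
  obtain ⟨tZ, htZ, htZi, htZ1⟩ : ∃ t : Measure ↥(Subgroup.centralizer ({γ} : Set ((cmDatum L 2 (Matrix.of fun i j : Fin 2 => if i.val + j.val + 1 = 2 then (1 : L) else 0)).Local v))),
      t.IsHaarMeasure ∧ t.IsInvInvariant ∧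
        t (compactCore ↥(Subgroup.centralizer ({γ} : Set ((cmDatum L 2 (Matrix.of fun i j : Fin 2 => if i.val + j.val + 1 = 2 then (1 : L) else 0)).Local v)))) = 1 :=
    forall_isRegularElt_exists_isHaarMeasure_compactCore_centralizer_local_eq_one (IsCMField.complexConj L) 2 _ hc hΦ₂ hΦ₂d γ hreg
  haveI := htZ
  haveI := htZi
  have hP : ∀ g x : (cmDatum L 2 (Matrix.of fun i j : Fin 2 => if i.val + j.val + 1 = 2 then (1 : L) else 0)).Local v, IsRegularElt (g.val : GL (Fin 2) (LocalRing L v)) → IsRegularElt ((x * g * x⁻¹).val : GL (Fin 2) (LocalRing L v)) :=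
    fun g x hg => (Literature.NumberTheory.Rogawski1990.isRegularElt_conj_iff (x.val : GL (Fin 2) (LocalRing L v)) (g.val : GL (Fin 2) (LocalRing L v))).2 hg
  rw [hm.classOrbitalIntegral_mk_eq_orbitalIntegral' hP hreg tZ htZ1, hm.classOrbitalIntegral_mk_eq_orbitalIntegral' hP hreg tZ htZ1,
    orbitalIntegral_indicator_complex_eq_ofReal γ I, orbitalIntegral_indicator_complex_eq_ofReal γ (cmLocalIntegralLevel L 2 (Matrix.of fun i j : Fin 2 => if i.val + j.val + 1 = 2 then (1 : L) else 0) v),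
    orbitalIntegral_indicator_eq_toReal_lintegral γ I hIo, orbitalIntegral_indicator_eq_toReal_lintegral γ (cmLocalIntegralLevel L 2 (Matrix.of fun i j : Fin 2 => if i.val + j.val + 1 = 2 then (1 : L) else 0) v) hKco.2]
  -- Step 2: the re-spelled carrier `G₂ = U(Φ₂)(L⁺_v)` with its Borel data, and `Ψ : U₂ ≃ G₂` (identity on matrices)
  set G2 := ↥(unitaryGroupOfForm (conjLocal L (IsCMField.complexConj L) v) (cmLocalForm L 2 v)) with hG2def
  let Ψ : ((cmDatum L 2 (Matrix.of fun i j : Fin 2 => if i.val + j.val + 1 = 2 then (1 : L) else 0)).Local v) ≃* G2 :=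
    { toFun := fun g => ⟨g.val, g.property⟩
      invFun := fun g => ⟨g.val, g.property⟩
      left_inv := fun _ => rfl
      right_inv := fun _ => rfl
      map_mul' := fun _ _ => rfl }
  have hΨ : Continuous Ψ := continuous_subtype_val.subtype_mk _
  have hΨs : Continuous Ψ.symm := continuous_subtype_val.subtype_mk _
  set t : G2 := Ψ γ with htdef
  have ht : t ∈ (torusU (conjLocal L (IsCMField.complexConj L) v) (cmLocalForm L 2 v)) := ⟨d, hd⟩
  have hdt : glDiagonal 2 (LocalRing L v) d = (t : GL (Fin 2) (LocalRing L v)) := hd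
  letI mG2 : MeasurableSpace G2 := borel _
  haveI : BorelSpace G2 := ⟨rfl⟩
  haveI : LocallyCompactSpace G2 := locallyCompactSpace_local (IsCMField.complexConj L) 2 _ v
  haveI : SecondCountableTopology G2 := secondCountableTopology_local (IsCMField.complexConj L) 2 _ v
  letI mQ : MeasurableSpace (G2 ⧸ (torusU (conjLocal L (IsCMField.complexConj L) v) (cmLocalForm L 2 v))) := borel _
  haveI : BorelSpace (G2 ⧸ (torusU (conjLocal L (IsCMField.complexConj L) v) (cmLocalForm L 2 v))) := ⟨rfl⟩
  obtain ⟨K2, hK2⟩ : ∃ K2 : Subgroup G2, K2 = (cmLocalIntegralLevel L 2 (Matrix.of fun i j : Fin 2 => if i.val + j.val + 1 = 2 then (1 : L) else 0) v) := ⟨_, rfl⟩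
  obtain ⟨I2, hI2⟩ : ∃ I2 : Subgroup G2, I2 = I := ⟨_, rfl⟩
  have hK2co : IsCompact (K2 : Set G2) ∧ IsOpen (K2 : Set G2) := by rw [hK2]; exact hKco
  have hI2o : IsOpen (I2 : Set G2) := by rw [hI2]; exact hIo
  have hIK2 : I2 ≤ K2 := by rw [hI2, hK2]; exact hIK
  have hK' : ∀ g : ((cmDatum L 2 (Matrix.of fun i j : Fin 2 => if i.val + j.val + 1 = 2 then (1 : L) else 0)).Local v), g ∈ (cmLocalIntegralLevel L 2 (Matrix.of fun i j : Fin 2 => if i.val + j.val + 1 = 2 then (1 : L) else 0) v) ↔ Ψ g ∈ K2 := fun g => by rw [hK2]; exact Iff.rfl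
  have hI' : ∀ g : ((cmDatum L 2 (Matrix.of fun i j : Fin 2 => if i.val + j.val + 1 = 2 then (1 : L) else 0)).Local v), g ∈ I ↔ Ψ g ∈ I2 := fun g => by rw [hI2]; exact Iff.rfl
  -- the upper-Iwahori criterion, read on `G₂`
  have hI2mem : ∀ u : G2, u ∈ I2 ↔ u ∈ K2 ∧ Valued.v (((u : GL (Fin 2) (LocalRing L v)).val 1 0) w) < 1 := fun u => by
    rw [hI2, hK2]; exact hI (Ψ.symm u)
  haveI hT : IsClosed (((torusU (conjLocal L (IsCMField.complexConj L) v) (cmLocalForm L 2 v)) : Subgroup G2) : Set G2) := isClosed_torusU_two _ _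
  have hN : IsClosed (((unipotentU (conjLocal L (IsCMField.complexConj L) v) (cmLocalForm L 2 v)) : Subgroup G2) : Set G2) := isClosed_unipotentU _ _
  haveI hZc : IsClosed ((Subgroup.centralizer ({γ} : Set ((cmDatum L 2 (Matrix.of fun i j : Fin 2 => if i.val + j.val + 1 = 2 then (1 : L) else 0)).Local v)) : Subgroup ((cmDatum L 2 (Matrix.of fun i j : Fin 2 => if i.val + j.val + 1 = 2 then (1 : L) else 0)).Local v)) : Set ((cmDatum L 2 (Matrix.of fun i j : Fin 2 => if i.val + j.val + 1 = 2 then (1 : L) else 0)).Local v)) := isClosed_coe_centralizer_singleton γ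
  haveI : LocallyCompactSpace ↥(Subgroup.centralizer ({γ} : Set ((cmDatum L 2 (Matrix.of fun i j : Fin 2 => if i.val + j.val + 1 = 2 then (1 : L) else 0)).Local v))) := hZc.isClosedEmbedding_subtypeVal.locallyCompactSpace
  haveI : SecondCountableTopology ↥(Subgroup.centralizer ({γ} : Set ((cmDatum L 2 (Matrix.of fun i j : Fin 2 => if i.val + j.val + 1 = 2 then (1 : L) else 0)).Local v))) := TopologicalSpace.Subtype.secondCountableTopology _
  haveI : BorelSpace ↥(Subgroup.centralizer ({γ} : Set ((cmDatum L 2 (Matrix.of fun i j : Fin 2 => if i.val + j.val + 1 = 2 then (1 : L) else 0)).Local v))) := Subtype.borelSpace _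
  haveI : LocallyCompactSpace ↥(torusU (conjLocal L (IsCMField.complexConj L) v) (cmLocalForm L 2 v)) := hT.isClosedEmbedding_subtypeVal.locallyCompactSpace
  haveI : SecondCountableTopology ↥(torusU (conjLocal L (IsCMField.complexConj L) v) (cmLocalForm L 2 v)) := TopologicalSpace.Subtype.secondCountableTopology _
  haveI : LocallyCompactSpace ↥(unipotentU (conjLocal L (IsCMField.complexConj L) v) (cmLocalForm L 2 v)) := hN.isClosedEmbedding_subtypeVal.locallyCompactSpace
  haveI : SecondCountableTopology ↥(unipotentU (conjLocal L (IsCMField.complexConj L) v) (cmLocalForm L 2 v)) := TopologicalSpace.Subtype.secondCountableTopology _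
  haveI : BorelSpace ↥(unipotentU (conjLocal L (IsCMField.complexConj L) v) (cmLocalForm L 2 v)) := Subtype.borelSpace _
  haveI : LocallyCompactSpace ↥K2 := hK2co.1.isClosed.isClosedEmbedding_subtypeVal.locallyCompactSpace
  haveI : SecondCountableTopology ↥K2 := TopologicalSpace.Subtype.secondCountableTopology _
  haveI : BorelSpace ↥K2 := Subtype.borelSpace _
  haveI : CompactSpace ↥K2 := isCompact_iff_compactSpace.1 hK2co.1
  -- `Ψ Z(γ) = T₂`
  have hZT : ∀ g : ((cmDatum L 2 (Matrix.of fun i j : Fin 2 => if i.val + j.val + 1 = 2 then (1 : L) else 0)).Local v), Ψ g ∈ (torusU (conjLocal L (IsCMField.complexConj L) v) (cmLocalForm L 2 v)) ↔ g ∈ Subgroup.centralizer ({γ} : Set ((cmDatum L 2 (Matrix.of fun i j : Fin 2 => if i.val + j.val + 1 = 2 then (1 : L) else 0)).Local v)) := by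
    intro g
    rw [mem_torusU_iff_mem_centralizer_of_isUnit_sub hdt hregd (Ψ g), Subgroup.mem_centralizer_singleton_iff,
      Subgroup.mem_centralizer_singleton_iff]
    change Ψ g * Ψ γ = Ψ γ * Ψ g ↔ g * γ = γ * g
    rw [← map_mul, ← map_mul, Ψ.injective.eq_iff]
  -- Step 3: Haar measures on `G₂`, `T₂`, `K₂`, `N₂` and the Iwasawa form of `Ψ_*ν ∕ Ψ_*t_Z`
  obtain ⟨ν', hν'⟩ : ∃ ν' : Measure G2, ν' = Measure.map Ψ ν := ⟨_, rfl⟩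
  haveI : ν'.IsHaarMeasure := by rw [hν']; exact MulEquiv.isHaarMeasure_map ν Ψ hΨ hΨs
  haveI : ν'.IsMulRightInvariant := by rw [hν']; exact isMulRightInvariant_map_mulEquiv_of_isMulRightInvariant Ψ hΨ.measurable ν
  let eH := subgroupCongrHomeomorph Ψ (Subgroup.centralizer ({γ} : Set ((cmDatum L 2 (Matrix.of fun i j : Fin 2 => if i.val + j.val + 1 = 2 then (1 : L) else 0)).Local v))) (torusU (conjLocal L (IsCMField.complexConj L) v) (cmLocalForm L 2 v)) hZT hΨ hΨs
  let eZ : ↥(Subgroup.centralizer ({γ} : Set ((cmDatum L 2 (Matrix.of fun i j : Fin 2 => if i.val + j.val + 1 = 2 then (1 : L) else 0)).Local v))) ≃ₜ* ↥(torusU (conjLocal L (IsCMField.complexConj L) v) (cmLocalForm L 2 v)) :=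
    { toMulEquiv :=
        { toEquiv := eH.toEquiv
          map_mul' := fun a b => Subtype.ext (map_mul Ψ (a : ((cmDatum L 2 (Matrix.of fun i j : Fin 2 => if i.val + j.val + 1 = 2 then (1 : L) else 0)).Local v)) (b : ((cmDatum L 2 (Matrix.of fun i j : Fin 2 => if i.val + j.val + 1 = 2 then (1 : L) else 0)).Local v))) }
      continuous_toFun := eH.continuous
      continuous_invFun := eH.symm.continuous }
  have heZ : (eZ : _ → ↥(torusU (conjLocal L (IsCMField.complexConj L) v) (cmLocalForm L 2 v))) = eH := rfl
  obtain ⟨tT, htT⟩ : ∃ tT : Measure ↥(torusU (conjLocal L (IsCMField.complexConj L) v) (cmLocalForm L 2 v)), tT = Measure.map eH tZ := ⟨_, rfl⟩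
  haveI : tT.IsHaarMeasure := by rw [htT, ← heZ]; exact MulEquiv.isHaarMeasure_map tZ eZ.toMulEquiv eZ.continuous eZ.symm.continuous
  haveI : tT.IsInvInvariant := by rw [htT, ← heZ]; exact isInvInvariant_map_mulEquiv eZ.toMulEquiv eZ.continuous.measurable tZ
  obtain ⟨κ, hκ⟩ : ∃ κ : Measure ↥K2, κ.IsHaarMeasure := ⟨Measure.haar, inferInstance⟩
  obtain ⟨μN, hμN⟩ : ∃ μN : Measure ↥(unipotentU (conjLocal L (IsCMField.complexConj L) v) (cmLocalForm L 2 v)), μN.IsHaarMeasure := ⟨Measure.haar, inferInstance⟩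
  obtain ⟨α, hα⟩ : ∃ α : Measure ↥(torusU (conjLocal L (IsCMField.complexConj L) v) (cmLocalForm L 2 v)), α.IsHaarMeasure := ⟨Measure.haar, inferInstance⟩
  haveI : SMulInvariantMeasure G2 (G2 ⧸ (torusU (conjLocal L (IsCMField.complexConj L) v) (cmLocalForm L 2 v))) (quotientMeasure (torusU (conjLocal L (IsCMField.complexConj L) v) (cmLocalForm L 2 v)) tT hT ν') := smulInvariantMeasure_quotientMeasure _ tT hT ν'
  have hμ0 : quotientMeasure (torusU (conjLocal L (IsCMField.complexConj L) v) (cmLocalForm L 2 v)) tT hT ν' ≠ 0 := quotientMeasure_ne_zero _ tT hT ν'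
  have hKB : ∀ g : G2, ∃ k ∈ K2, ∃ b ∈ borelU (conjLocal L (IsCMField.complexConj L) v) (cmLocalForm L 2 v), g = k * b := fun g => by
    obtain ⟨k, hk, b, hb⟩ := exists_mem_cmLocalIntegralLevel_mul_borel L 2 v g
    exact ⟨k, by rw [hK2]; exact hk, b.1, b.2, hb⟩
  obtain ⟨C, -, hμC⟩ := exists_measure_quotient_torusU_cmLocal_two_eq_smul_map L v hK2co.1 hKB κ α μN (quotientMeasure (torusU (conjLocal L (IsCMField.complexConj L) v) (cmLocalForm L 2 v)) tT hT ν') hμ0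
  -- Step 4: both units transported to `G₂ ⧸ T₂` and unfolded in Iwasawa coordinates (`C`, `J_H(γ)` common)
  have hFI : ((I : Set ((cmDatum L 2 (Matrix.of fun i j : Fin 2 => if i.val + j.val + 1 = 2 then (1 : L) else 0)).Local v)).indicator (1 : ((cmDatum L 2 (Matrix.of fun i j : Fin 2 => if i.val + j.val + 1 = 2 then (1 : L) else 0)).Local v) → ℝ≥0∞)) = ((I2 : Set G2).indicator (1 : G2 → ℝ≥0∞)) ∘ Ψ := by
    funext g
    by_cases hg : g ∈ I
    · rw [Set.indicator_of_mem (show g ∈ (I : Set ((cmDatum L 2 (Matrix.of fun i j : Fin 2 => if i.val + j.val + 1 = 2 then (1 : L) else 0)).Local v)) from hg), Function.comp_apply,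
        Set.indicator_of_mem (show Ψ g ∈ (I2 : Set G2) from (hI' g).1 hg)]; rfl
    · rw [Set.indicator_of_notMem (show g ∉ (I : Set ((cmDatum L 2 (Matrix.of fun i j : Fin 2 => if i.val + j.val + 1 = 2 then (1 : L) else 0)).Local v)) from hg), Function.comp_apply,
        Set.indicator_of_notMem (show Ψ g ∉ (I2 : Set G2) from fun h => hg ((hI' g).2 h))]
  have hFK : (((cmLocalIntegralLevel L 2 (Matrix.of fun i j : Fin 2 => if i.val + j.val + 1 = 2 then (1 : L) else 0) v) : Set ((cmDatum L 2 (Matrix.of fun i j : Fin 2 => if i.val + j.val + 1 = 2 then (1 : L) else 0)).Local v)).indicator (1 : ((cmDatum L 2 (Matrix.of fun i j : Fin 2 => if i.val + j.val + 1 = 2 then (1 : L) else 0)).Local v) → ℝ≥0∞)) = ((K2 : Set G2).indicator (1 : G2 → ℝ≥0∞)) ∘ Ψ := by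
    funext g
    by_cases hg : g ∈ (cmLocalIntegralLevel L 2 (Matrix.of fun i j : Fin 2 => if i.val + j.val + 1 = 2 then (1 : L) else 0) v)
    · rw [Set.indicator_of_mem (show g ∈ ((cmLocalIntegralLevel L 2 (Matrix.of fun i j : Fin 2 => if i.val + j.val + 1 = 2 then (1 : L) else 0) v) : Set ((cmDatum L 2 (Matrix.of fun i j : Fin 2 => if i.val + j.val + 1 = 2 then (1 : L) else 0)).Local v)) from hg), Function.comp_apply,
        Set.indicator_of_mem (show Ψ g ∈ (K2 : Set G2) from (hK' g).1 hg)]; rfl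
    · rw [Set.indicator_of_notMem (show g ∉ ((cmLocalIntegralLevel L 2 (Matrix.of fun i j : Fin 2 => if i.val + j.val + 1 = 2 then (1 : L) else 0) v) : Set ((cmDatum L 2 (Matrix.of fun i j : Fin 2 => if i.val + j.val + 1 = 2 then (1 : L) else 0)).Local v)) from hg), Function.comp_apply,
        Set.indicator_of_notMem (show Ψ g ∉ (K2 : Set G2) from fun h => hg ((hK' g).2 h))]
  have hmI : Measurable ((I2 : Set G2).indicator (1 : G2 → ℝ≥0∞)) := measurable_one.indicator hI2o.measurableSet
  have hmK : Measurable ((K2 : Set G2).indicator (1 : G2 → ℝ≥0∞)) := measurable_one.indicator hK2co.2.measurableSet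
  rw [hFI, hFK,
    ← lintegral_descConj_quotientMeasure_eq_of_mulEquiv Ψ hΨ hΨs (Subgroup.centralizer ({γ} : Set ((cmDatum L 2 (Matrix.of fun i j : Fin 2 => if i.val + j.val + 1 = 2 then (1 : L) else 0)).Local v))) (torusU (conjLocal L (IsCMField.complexConj L) v) (cmLocalForm L 2 v)) hZT tZ tT ν ν' htT hν'
      (fun _ hg => Subgroup.mem_centralizer_singleton_iff.1 hg) (forall_mem_torusU_cmLocal_two_comm L v ht),
    ← lintegral_descConj_quotientMeasure_eq_of_mulEquiv Ψ hΨ hΨs (Subgroup.centralizer ({γ} : Set ((cmDatum L 2 (Matrix.of fun i j : Fin 2 => if i.val + j.val + 1 = 2 then (1 : L) else 0)).Local v))) (torusU (conjLocal L (IsCMField.complexConj L) v) (cmLocalForm L 2 v)) hZT tZ tT ν ν' htT hν'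
      (fun _ hg => Subgroup.mem_centralizer_singleton_iff.1 hg) (forall_mem_torusU_cmLocal_two_comm L v ht),
    lintegral_descConj_torusU_cmLocal_two_regular_eq_mul_lintegral_prod L v κ μN _ hμC ht hdt hb hmI,
    lintegral_descConj_torusU_cmLocal_two_regular_eq_mul_lintegral_prod L v κ μN _ hμC ht hdt hb hmK]
  -- Step 5: «rank-one Iwahori position» of `(K₂, I₂, T₂, N₂, w₀ = Φ₂)` and the two `K₂ × N₂` integrals
  obtain ⟨w₀, hw₀, hw₀i⟩ := exists_weylElement_two L v
  have hJle : ∀ (i j : Fin 2) (w' : PlacesOver L v), Valued.v (cmLocalForm L 2 v i j w') ≤ 1 := by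
    intro i j w'
    obtain ⟨h00, h01, h10, h11⟩ := antidiagonal_over_two_apply (R := LocalRing L v)
    rw [hJ]
    fin_cases i <;> fin_cases j <;>
      simp only [Fin.zero_eta, Fin.mk_one, Fin.isValue, h00, h01, h10, h11, Pi.zero_apply, Pi.one_apply, map_zero, map_one,
        zero_le_one, le_refl]
  have hw₀K : w₀ ∈ K2 := by
    rw [hK2]
    refine (mem_cmLocalIntegralLevel_iff_forall_v_le_one L 2 v w₀).2 ⟨fun i j w' => ?_, fun i j w' => ?_⟩
    · rw [hw₀]; exact hJle i j w'
    · rw [hw₀i]; exact hJle i j w'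
  -- (bo): `T₂ ∩ K₂ ⊆ I₂`, `N₂ ∩ K₂ ⊆ I₂`, `w₀ (T₂ ∩ K₂) w₀⁻¹ ⊆ I₂`
  have hv0 : Valued.v ((0 : LocalRing L v) w) < 1 := by rw [Pi.zero_apply, map_zero]; exact zero_lt_one
  have hTI : ∀ a ∈ (torusU (conjLocal L (IsCMField.complexConj L) v) (cmLocalForm L 2 v)), a ∈ K2 → a ∈ I2 := by
    rintro a ⟨d', hd'⟩ haK
    refine (hI2mem a).2 ⟨haK, ?_⟩
    have ha : (a : GL (Fin 2) (LocalRing L v)) = glDiagonal 2 (LocalRing L v) d' := hd'.symm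
    rw [ha, coe_glDiagonal, Matrix.diagonal_apply_ne _ (by decide)]
    exact hv0
  have hNI : ∀ n ∈ (unipotentU (conjLocal L (IsCMField.complexConj L) v) (cmLocalForm L 2 v)), n ∈ K2 → n ∈ I2 := fun n hn hnK =>
    (hI2mem n).2 ⟨hnK, by rw [(umat_shape_two (conjLocal L (IsCMField.complexConj L) v) ⟨n, hn⟩).1]; exact hv0⟩
  have hwT : ∀ a ∈ (torusU (conjLocal L (IsCMField.complexConj L) v) (cmLocalForm L 2 v)), a ∈ K2 → w₀ * a * w₀⁻¹ ∈ I2 := by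
    rintro a ⟨d', hd'⟩ haK
    refine (hI2mem _).2 ⟨mul_mem (mul_mem hw₀K haK) (inv_mem hw₀K), ?_⟩
    have ha : (a : GL (Fin 2) (LocalRing L v)) = glDiagonal 2 (LocalRing L v) d' := hd'.symm
    have hent : ((w₀ * a * w₀⁻¹ : G2) : GL (Fin 2) (LocalRing L v)).val 1 0 = 0 := by
      rw [Subgroup.coe_mul, Subgroup.coe_mul, Units.val_mul, Units.val_mul, hw₀i, Matrix.mul_apply, Fin.sum_univ_two,
        Matrix.mul_apply, Matrix.mul_apply, Fin.sum_univ_two, Fin.sum_univ_two, hw₀, ha, coe_glDiagonal,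
        Matrix.diagonal_apply_ne _ (show (0 : Fin 2) ≠ 1 by decide), Matrix.diagonal_apply_ne _ (show (1 : Fin 2) ≠ 0 by decide), hJ,
        antidiagonal_over_two_apply.1, antidiagonal_over_two_apply.2.2.1, antidiagonal_over_two_apply.2.2.2]
      ring
    rw [hent]; exact hv0
  -- (gp), `T₂` normalises the abelian `N₂`
  have hKP : ∀ ⦃a n : G2⦄, a ∈ (torusU (conjLocal L (IsCMField.complexConj L) v) (cmLocalForm L 2 v)) → n ∈ (unipotentU (conjLocal L (IsCMField.complexConj L) v) (cmLocalForm L 2 v)) → a * n ∈ K2 → a ∈ K2 := by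
    rw [hK2]; exact mem_cmLocalIntegralLevel_of_torus_mul_unipotent L 2 v
  have hTN : ∀ a ∈ (torusU (conjLocal L (IsCMField.complexConj L) v) (cmLocalForm L 2 v)), ∀ n ∈ (unipotentU (conjLocal L (IsCMField.complexConj L) v) (cmLocalForm L 2 v)), a⁻¹ * n * a ∈ (unipotentU (conjLocal L (IsCMField.complexConj L) v) (cmLocalForm L 2 v)) := fun a ha n hn =>
    (torus_inv_conj_mem_unipotentU_iff (conjLocal L (IsCMField.complexConj L) v) (cmLocalForm L 2 v) ha n).2 hn
  have hNc : ∀ a ∈ (unipotentU (conjLocal L (IsCMField.complexConj L) v) (cmLocalForm L 2 v)), ∀ b ∈ (unipotentU (conjLocal L (IsCMField.complexConj L) v) (cmLocalForm L 2 v)), a * b = b * a := fun a ha b hb =>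
    congrArg Subtype.val (mul_comm_two (conjLocal L (IsCMField.complexConj L) v) (J := cmLocalForm L 2 v) ⟨a, ha⟩ ⟨b, hb⟩)
  -- (br): the Bruhat decomposition `K₂ = I₂ ⊔ I₂ w₀ (N₂ ∩ K₂)` — off `I₂` the `(1,0)` entry is a unit at `w`
  have hBr : ∀ k ∈ K2, k ∉ I2 → ∃ i ∈ I2, ∃ x ∈ (unipotentU (conjLocal L (IsCMField.complexConj L) v) (cmLocalForm L 2 v)), x ∈ K2 ∧ k = i * w₀ * x := by
    intro k hk hkI
    have hk' : k ∈ (cmLocalIntegralLevel L 2 (Matrix.of fun i j : Fin 2 => if i.val + j.val + 1 = 2 then (1 : L) else 0) v) := by rw [← hK2]; exact hk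
    have hle : ∀ (i j : Fin 2) (w' : PlacesOver L v), Valued.v (((k : GL (Fin 2) (LocalRing L v)).val i j) w') ≤ 1 :=
      fun i j w' => v_apply_le_one_of_mem_cmLocalIntegralLevel L 2 v k hk' i j w'
    have hv1 : Valued.v (((k : GL (Fin 2) (LocalRing L v)).val 1 0) w) = 1 :=
      le_antisymm (hle 1 0 w) (not_lt.1 fun h => hkI ((hI2mem k).2 ⟨hk, h⟩))
    have hne : ∀ w' : PlacesOver L v, ((k : GL (Fin 2) (LocalRing L v)).val 1 0) w' ≠ 0 := by
      intro w'
      obtain rfl : w = w' := Subsingleton.elim w w'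
      intro h0
      rw [h0, map_zero] at hv1
      exact zero_ne_one hv1
    have hu : IsUnit (((k : GL (Fin 2) (LocalRing L v)).val 1 0)) :=
      isUnit_iff_exists_inv.2 ⟨fun w' => ((((k : GL (Fin 2) (LocalRing L v)).val 1 0) w'))⁻¹, funext fun w' => mul_inv_cancel₀ (hne w')⟩
    obtain ⟨x, hx01, hi10⟩ := exists_unipotent_bruhat_two (conjLocal L (IsCMField.complexConj L) v) hJ k w₀ hw₀ hu.unit hu.unit_spec
    obtain ⟨hx10, hx00, hx11⟩ := umat_shape_two (conjLocal L (IsCMField.complexConj L) v) x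
    obtain ⟨hxi10, hxi00, hxi11⟩ := umat_shape_two (conjLocal L (IsCMField.complexConj L) v) x⁻¹
    have hxi01 := umat_inv_zero_one_two (conjLocal L (IsCMField.complexConj L) v) x
    -- the valuation of `y = u⁻¹ k₁₁` at every `w′ ∣ v`
    have hvy : ∀ w' : PlacesOver L v, Valued.v ((((hu.unit⁻¹ : (LocalRing L v)ˣ) : LocalRing L v) *
        ((k : GL (Fin 2) (LocalRing L v)).val 1 1)) w') ≤ 1 := by
      intro w'
      obtain rfl : w = w' := Subsingleton.elim w w'
      have hinv : (((hu.unit⁻¹ : (LocalRing L v)ˣ) : LocalRing L v) w) * (((k : GL (Fin 2) (LocalRing L v)).val 1 0) w) = 1 := by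
        have h := congrArg (fun f : LocalRing L v => f w) hu.unit.inv_mul
        simp only [Pi.mul_apply, Pi.one_apply, IsUnit.unit_spec] at h
        exact h
      have hvinv : Valued.v (((hu.unit⁻¹ : (LocalRing L v)ˣ) : LocalRing L v) w) = 1 := by
        have h := congrArg Valued.v hinv
        rw [map_mul, hv1, mul_one, map_one] at h
        exact h
      rw [Pi.mul_apply, map_mul, hvinv, one_mul]
      exact hle 1 1 w
    have hxK : (x : G2) ∈ K2 := by
      rw [hK2]
      refine (mem_cmLocalIntegralLevel_iff_forall_v_le_one L 2 v (x : G2)).2 ⟨fun i j w' => ?_, fun i j w' => ?_⟩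
      · fin_cases i <;> fin_cases j <;> simp only [Fin.zero_eta, Fin.mk_one, Fin.isValue]
        · rw [show ((x : G2) : GL (Fin 2) (LocalRing L v)).val 0 0 = 1 from hx00, Pi.one_apply, map_one]
        · rw [show ((x : G2) : GL (Fin 2) (LocalRing L v)).val 0 1 = _ from hx01]; exact hvy w'
        · rw [show ((x : G2) : GL (Fin 2) (LocalRing L v)).val 1 0 = 0 from hx10, Pi.zero_apply, map_zero]; exact zero_le_one
        · rw [show ((x : G2) : GL (Fin 2) (LocalRing L v)).val 1 1 = 1 from hx11, Pi.one_apply, map_one]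
      · have hxinv : ((x : G2)⁻¹ : G2) = ((x⁻¹ : ↥(unipotentU (conjLocal L (IsCMField.complexConj L) v) (cmLocalForm L 2 v))) : G2) := rfl
        rw [hxinv]
        fin_cases i <;> fin_cases j <;> simp only [Fin.zero_eta, Fin.mk_one, Fin.isValue]
        · rw [show (((x⁻¹ : ↥(unipotentU (conjLocal L (IsCMField.complexConj L) v) (cmLocalForm L 2 v))) : G2) : GL (Fin 2) (LocalRing L v)).val 0 0 = 1 from hxi00, Pi.one_apply, map_one]
        · rw [show (((x⁻¹ : ↥(unipotentU (conjLocal L (IsCMField.complexConj L) v) (cmLocalForm L 2 v))) : G2) : GL (Fin 2) (LocalRing L v)).val 0 1 = _ from hxi01, hx01, Pi.neg_apply, Valuation.map_neg]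
          exact hvy w'
        · rw [show (((x⁻¹ : ↥(unipotentU (conjLocal L (IsCMField.complexConj L) v) (cmLocalForm L 2 v))) : G2) : GL (Fin 2) (LocalRing L v)).val 1 0 = 0 from hxi10, Pi.zero_apply, map_zero]; exact zero_le_one
        · rw [show (((x⁻¹ : ↥(unipotentU (conjLocal L (IsCMField.complexConj L) v) (cmLocalForm L 2 v))) : G2) : GL (Fin 2) (LocalRing L v)).val 1 1 = 1 from hxi11, Pi.one_apply, map_one]
    refine ⟨k * (x : G2)⁻¹ * w₀⁻¹, (hI2mem _).2 ⟨mul_mem (mul_mem hk (inv_mem hxK)) (inv_mem hw₀K), ?_⟩, x, x.2, hxK, by group⟩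
    rw [show ((k * (x : G2)⁻¹ * w₀⁻¹ : G2) : GL (Fin 2) (LocalRing L v)).val 1 0 = 0 from hi10]
    exact hv0
  have hdisj : ∀ x ∈ (unipotentU (conjLocal L (IsCMField.complexConj L) v) (cmLocalForm L 2 v)), x ∈ K2 → w₀ * x ∉ I2 := by
    intro x hx _ hmem
    have hlt := ((hI2mem _).1 hmem).2
    obtain ⟨hx10, hx00, -⟩ := umat_shape_two (conjLocal L (IsCMField.complexConj L) v) ⟨x, hx⟩
    have hent : ((w₀ * x : G2) : GL (Fin 2) (LocalRing L v)).val 1 0 = 1 := by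
      rw [Subgroup.coe_mul, Units.val_mul, Matrix.mul_apply, Fin.sum_univ_two, hw₀,
        show ((x : G2) : GL (Fin 2) (LocalRing L v)).val 0 0 = 1 from hx00, show ((x : G2) : GL (Fin 2) (LocalRing L v)).val 1 0 = 0 from hx10,
        hJ, antidiagonal_over_two_apply.2.2.1, antidiagonal_over_two_apply.2.2.2]
      ring
    rw [hent, Pi.one_apply, map_one] at hlt
    exact lt_irrefl _ hlt
  -- measurability of the two `K₂ × N₂` integrands
  haveI : BorelSpace (↥K2 × ↥(unipotentU (conjLocal L (IsCMField.complexConj L) v) (cmLocalForm L 2 v))) := Prod.borelSpace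
  have hφ : Continuous fun p : ↥K2 × ↥(unipotentU (conjLocal L (IsCMField.complexConj L) v) (cmLocalForm L 2 v)) => (p.1 : G2) * (t * (p.2 : G2)) * (p.1 : G2)⁻¹ :=
    ((continuous_subtype_val.comp continuous_fst).mul (continuous_const.mul (continuous_subtype_val.comp continuous_snd))).mul
      (continuous_subtype_val.comp continuous_fst).inv
  have hF : Measurable fun p : ↥K2 × ↥(unipotentU (conjLocal L (IsCMField.complexConj L) v) (cmLocalForm L 2 v)) => (I2 : Set G2).indicator (1 : G2 → ℝ≥0∞) ((p.1 : G2) * (t * (p.2 : G2)) * (p.1 : G2)⁻¹) :=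
    hmI.comp hφ.measurable
  have hS : MeasurableSet {u : ↥(unipotentU (conjLocal L (IsCMField.complexConj L) v) (cmLocalForm L 2 v)) | (u : G2) ∈ K2} := measurableSet_setOf_coe_mem_of_isOpen hK2co.2
  rw [lintegral_prod_indicator_iwahori_conj_torus_mul_unipotent κ μN hIK2 hI2o hK2co.1 hK2co.2.measurableSet hw₀K hTI hNI hKP hTN hNc hwT
      hBr hdisj ht hF,
    lintegral_prod_indicator_conj_levi_mul_unipotent κ μN hKP ht hS]
  -- Step 6: `ν(K)·κ(I₂) = ν(I)·κ(K₂)` (both are `[K : I]`-multiples) and the final arithmetic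
  haveI : Finite (↥K2 ⧸ I2.subgroupOf K2) := Subgroup.quotient_finite_of_isOpen _ (hI2o.preimage continuous_subtype_val)
  haveI : (I2.subgroupOf K2).FiniteIndex := Subgroup.finiteIndex_of_finite_quotient
  have hκidx := (I2.subgroupOf K2).index_mul_measure (hI2o.preimage continuous_subtype_val).measurableSet κ
  have hidx : (I2.subgroupOf K2).index = I.relIndex (cmLocalIntegralLevel L 2 (Matrix.of fun i j : Fin 2 => if i.val + j.val + 1 = 2 then (1 : L) else 0) v) := by cases hK2; cases hI2; rfl
  have hνidx := (measure_subgroup_eq_relIndex_mul_of_isCompact ν hIK hKco.1 hKco.2 hIo).2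
  have hIKset : ((I2.subgroupOf K2 : Subgroup ↥K2) : Set ↥K2) = {k : ↥K2 | (k : G2) ∈ I2} := rfl
  rw [hIKset, hidx] at hκidx
  -- finiteness and positivity of `ν I`, `ν K`
  have hνK_top : ν (((cmLocalIntegralLevel L 2 (Matrix.of fun i j : Fin 2 => if i.val + j.val + 1 = 2 then (1 : L) else 0) v) : Subgroup ((cmDatum L 2 (Matrix.of fun i j : Fin 2 => if i.val + j.val + 1 = 2 then (1 : L) else 0)).Local v)) : Set ((cmDatum L 2 (Matrix.of fun i j : Fin 2 => if i.val + j.val + 1 = 2 then (1 : L) else 0)).Local v)) ≠ ∞ := hKco.1.measure_lt_top.ne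
  have hνI_top : ν (I : Set ((cmDatum L 2 (Matrix.of fun i j : Fin 2 => if i.val + j.val + 1 = 2 then (1 : L) else 0)).Local v)) ≠ ∞ := (lt_of_le_of_lt (measure_mono hIK) hKco.1.measure_lt_top).ne
  have hνI_ne : ν (I : Set ((cmDatum L 2 (Matrix.of fun i j : Fin 2 => if i.val + j.val + 1 = 2 then (1 : L) else 0)).Local v)) ≠ 0 := hIo.measure_ne_zero ν ⟨1, one_mem I⟩
  have hνK_ne : ν (((cmLocalIntegralLevel L 2 (Matrix.of fun i j : Fin 2 => if i.val + j.val + 1 = 2 then (1 : L) else 0) v) : Subgroup ((cmDatum L 2 (Matrix.of fun i j : Fin 2 => if i.val + j.val + 1 = 2 then (1 : L) else 0)).Local v)) : Set ((cmDatum L 2 (Matrix.of fun i j : Fin 2 => if i.val + j.val + 1 = 2 then (1 : L) else 0)).Local v)) ≠ 0 := hKco.2.measure_ne_zero ν ⟨1, one_mem _⟩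
  have hIr : (ν (I : Set ((cmDatum L 2 (Matrix.of fun i j : Fin 2 => if i.val + j.val + 1 = 2 then (1 : L) else 0)).Local v))).toReal ≠ 0 := (ENNReal.toReal_pos hνI_ne hνI_top).ne'
  have hKr : (ν (((cmLocalIntegralLevel L 2 (Matrix.of fun i j : Fin 2 => if i.val + j.val + 1 = 2 then (1 : L) else 0) v) : Subgroup ((cmDatum L 2 (Matrix.of fun i j : Fin 2 => if i.val + j.val + 1 = 2 then (1 : L) else 0)).Local v)) : Set ((cmDatum L 2 (Matrix.of fun i j : Fin 2 => if i.val + j.val + 1 = 2 then (1 : L) else 0)).Local v))).toReal ≠ 0 := (ENNReal.toReal_pos hνK_ne hνK_top).ne'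
  -- the two index identities in `ℝ`, then the final arithmetic in `ℂ`
  have hr0 : ((I.relIndex (cmLocalIntegralLevel L 2 (Matrix.of fun i j : Fin 2 => if i.val + j.val + 1 = 2 then (1 : L) else 0) v) : ℕ) : ℂ) ≠ 0 :=
    Nat.cast_ne_zero.2 (measure_subgroup_eq_relIndex_mul_of_isCompact ν hIK hKco.1 hKco.2 hIo).1
  have hνK' : (ν ((cmLocalIntegralLevel L 2 (Matrix.of fun i j : Fin 2 => if i.val + j.val + 1 = 2 then (1 : L) else 0) v :
      Subgroup ((cmDatum L 2 (Matrix.of fun i j : Fin 2 => if i.val + j.val + 1 = 2 then (1 : L) else 0)).Local v)) :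
        Set ((cmDatum L 2 (Matrix.of fun i j : Fin 2 => if i.val + j.val + 1 = 2 then (1 : L) else 0)).Local v))).toReal =
      ((I.relIndex (cmLocalIntegralLevel L 2 (Matrix.of fun i j : Fin 2 => if i.val + j.val + 1 = 2 then (1 : L) else 0) v) : ℕ) : ℝ) *
        (ν (I : Set ((cmDatum L 2 (Matrix.of fun i j : Fin 2 => if i.val + j.val + 1 = 2 then (1 : L) else 0)).Local v))).toReal := by
    rw [hνidx, ENNReal.toReal_mul, ENNReal.toReal_natCast]
  have hκu' : (κ univ).toReal = ((I.relIndex (cmLocalIntegralLevel L 2 (Matrix.of fun i j : Fin 2 => if i.val + j.val + 1 = 2 then (1 : L) else 0) v) : ℕ) : ℝ) *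
      (κ {k : ↥K2 | (k : G2) ∈ I2}).toReal := by
    rw [← hκidx, ENNReal.toReal_mul, ENNReal.toReal_natCast]
  have hIc : ((ν (I : Set ((cmDatum L 2 (Matrix.of fun i j : Fin 2 => if i.val + j.val + 1 = 2 then (1 : L) else 0)).Local v))).toReal : ℂ) ≠ 0 :=
    Complex.ofReal_ne_zero.2 hIr
  simp only [ENNReal.toReal_mul, ENNReal.toReal_ofNat, hνK', hκu']
  push_cast
  field_simp

end CM

/-! ## §3 (ED. 2) The Iwahori criterion read from the ONE-PLACE token `iwahoriGL 2 L_w` (★ B-p10 `IwahoriGLTwoVertexStabilizers`: `K ⊓ K′ = I`) -/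

section IwahoriToken

variable (L : Type) [Field L] [NumberField L] [IsCMField L] {v : HeightOneSpectrum (𝓞 ↥(maximalRealSubfield L))}

/-- **The upper-Iwahori criterion of §2 from the one-place Iwahori token**: if `I ≤ U₂` is cut out by `u_w ∈ iwahoriGL 2 L_w` (B-p10's `K ⊓ K′ = I` road,
★ `inf_eq_of_mem_iff_glInt_of_mem_iff_iwahoriGL_of_valued_eq`), then `u ∈ I ↔ u ∈ K_v ∧ |(u₁₀)_w|_w < 1` — the binder `hI` of
`inv_measure_mul_classOrbitalIntegral_iwahori_eq_two_mul_of_torus_regular` (★ `mem_iwahoriGL_iff`, ★ `mem_localIntegralLevel_iff_of_smul_eq`, the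
`ValuativeRel ↔ Valued` bridge `Valuation.IsEquiv.lt_one_iff_lt_one`). [cite: CartierCorvallis1979, §III.5] [cite: Rogawski1990, §1.10 p. 9] -/
theorem mem_iff_mem_cmLocalIntegralLevel_and_v_lt_one_of_mem_iff_iwahoriGL
    (w : PlacesOver L v) (hw : IsCMField.complexConj L • w.1 = w.1) (I : Subgroup ((cmDatum L 2 (Matrix.of fun i j : Fin 2 => if i.val + j.val + 1 = 2 then (1 : L) else 0)).Local v))
    (hIw : ∀ u : ((cmDatum L 2 (Matrix.of fun i j : Fin 2 => if i.val + j.val + 1 = 2 then (1 : L) else 0)).Local v), u ∈ I ↔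
      ((localNonsplitEquiv (IsCMField.complexConj L) (Matrix.of fun i j : Fin 2 => if i.val + j.val + 1 = 2 then (1 : L) else 0) (IsCMField.complexConj_ne_one L) w hw u : ↥(unitaryGroupOfForm (galAdicCompletionMap (L := L) (IsCMField.complexConj L) hw) (placeForm (Matrix.of fun i j : Fin 2 => if i.val + j.val + 1 = 2 then (1 : L) else 0) w.1))) :
        GL (Fin 2) (w.1.adicCompletion L)) ∈ iwahoriGL 2 (w.1.adicCompletion L)) :
    ∀ u : ((cmDatum L 2 (Matrix.of fun i j : Fin 2 => if i.val + j.val + 1 = 2 then (1 : L) else 0)).Local v), u ∈ I ↔ u ∈ (cmLocalIntegralLevel L 2 (Matrix.of fun i j : Fin 2 => if i.val + j.val + 1 = 2 then (1 : L) else 0) v) ∧ Valued.v (((u.val : GL (Fin 2) (LocalRing L v)).val 1 0) w) < 1 := by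
  haveI : Algebra.IsQuadraticExtension ↥(maximalRealSubfield L) L := IsCMField.isQuadraticExtension L
  have he : (ValuativeRel.valuation (w.1.adicCompletion L)).IsEquiv (Valued.v : Valuation (w.1.adicCompletion L) (WithZero (Multiplicative ℤ))) :=
    ValuativeRel.isEquiv _ _
  intro u
  have hentry : ∀ i j : Fin 2, (((localNonsplitEquiv (IsCMField.complexConj L) (Matrix.of fun i j : Fin 2 => if i.val + j.val + 1 = 2 then (1 : L) else 0) (IsCMField.complexConj_ne_one L) w hw u : ↥(unitaryGroupOfForm (galAdicCompletionMap (L := L) (IsCMField.complexConj L) hw) (placeForm (Matrix.of fun i j : Fin 2 => if i.val + j.val + 1 = 2 then (1 : L) else 0) w.1))) :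
      GL (Fin 2) (w.1.adicCompletion L)) : Matrix (Fin 2) (Fin 2) (w.1.adicCompletion L)) i j = ((u.val : GL (Fin 2) (LocalRing L v)).val i j) w := by
    intro i j
    rw [coe_coe_localNonsplitEquiv_apply, Matrix.map_apply]
    rfl
  rw [hIw u, mem_iwahoriGL_iff, ← mem_localIntegralLevel_iff_of_smul_eq (IsCMField.complexConj L) 2 _ (IsCMField.complexConj_ne_one L) w hw u]
  refine and_congr Iff.rfl ⟨fun h => ?_, fun h i j hij => ?_⟩
  · have h10 := h 1 0 (by decide)
    rwa [he.lt_one_iff_lt_one, hentry] at h10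
  · have hij' : i = 1 ∧ j = 0 := by
      fin_cases i <;> fin_cases j <;> simp_all
    obtain ⟨rfl, rfl⟩ := hij'
    rw [he.lt_one_iff_lt_one, hentry]
    exact h

/-- **The Iwahori-unit ratio with the one-place token** — `inv_measure_mul_classOrbitalIntegral_iwahori_eq_two_mul_of_torus_regular` with its criterion binder `hI`
discharged by `mem_iff_mem_cmLocalIntegralLevel_and_v_lt_one_of_mem_iff_iwahoriGL` (the shape the (R2) assembly consumes after ★ B-p10's `K ⊓ K′ = I`).
[cite: Kottwitz1988, §2 Theorem 2] [cite: Rogawski1990, §12.6 p. 174; §4.9 (4.9.2) p. 55] -/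
theorem inv_measure_mul_classOrbitalIntegral_iwahoriGL_eq_two_mul_of_torus_regular
    (w : PlacesOver L v) (hw : IsCMField.complexConj L • w.1 = w.1)
    [MeasurableSpace ((cmDatum L 2 (Matrix.of fun i j : Fin 2 => if i.val + j.val + 1 = 2 then (1 : L) else 0)).Local v)] [BorelSpace ((cmDatum L 2 (Matrix.of fun i j : Fin 2 => if i.val + j.val + 1 = 2 then (1 : L) else 0)).Local v)]
    [∀ a : ((cmDatum L 2 (Matrix.of fun i j : Fin 2 => if i.val + j.val + 1 = 2 then (1 : L) else 0)).Local v), MeasurableSpace (((cmDatum L 2 (Matrix.of fun i j : Fin 2 => if i.val + j.val + 1 = 2 then (1 : L) else 0)).Local v) ⧸ Subgroup.centralizer ({a} : Set ((cmDatum L 2 (Matrix.of fun i j : Fin 2 => if i.val + j.val + 1 = 2 then (1 : L) else 0)).Local v)))]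
    [∀ a : ((cmDatum L 2 (Matrix.of fun i j : Fin 2 => if i.val + j.val + 1 = 2 then (1 : L) else 0)).Local v), BorelSpace (((cmDatum L 2 (Matrix.of fun i j : Fin 2 => if i.val + j.val + 1 = 2 then (1 : L) else 0)).Local v) ⧸ Subgroup.centralizer ({a} : Set ((cmDatum L 2 (Matrix.of fun i j : Fin 2 => if i.val + j.val + 1 = 2 then (1 : L) else 0)).Local v)))]
    (ν : Measure ((cmDatum L 2 (Matrix.of fun i j : Fin 2 => if i.val + j.val + 1 = 2 then (1 : L) else 0)).Local v)) [ν.IsHaarMeasure] [ν.IsMulRightInvariant]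
    {m : OrbitalMeasureFamily ((cmDatum L 2 (Matrix.of fun i j : Fin 2 => if i.val + j.val + 1 = 2 then (1 : L) else 0)).Local v)}
    (hm : m.IsCanonical (fun γ => IsRegularElt (γ.val : GL (Fin 2) (LocalRing L v))) ν)
    (I : Subgroup ((cmDatum L 2 (Matrix.of fun i j : Fin 2 => if i.val + j.val + 1 = 2 then (1 : L) else 0)).Local v)) (hIo : IsOpen (I : Set ((cmDatum L 2 (Matrix.of fun i j : Fin 2 => if i.val + j.val + 1 = 2 then (1 : L) else 0)).Local v)))
    (hIw : ∀ u : ((cmDatum L 2 (Matrix.of fun i j : Fin 2 => if i.val + j.val + 1 = 2 then (1 : L) else 0)).Local v), u ∈ I ↔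
      ((localNonsplitEquiv (IsCMField.complexConj L) (Matrix.of fun i j : Fin 2 => if i.val + j.val + 1 = 2 then (1 : L) else 0) (IsCMField.complexConj_ne_one L) w hw u : ↥(unitaryGroupOfForm (galAdicCompletionMap (L := L) (IsCMField.complexConj L) hw) (placeForm (Matrix.of fun i j : Fin 2 => if i.val + j.val + 1 = 2 then (1 : L) else 0) w.1))) :
        GL (Fin 2) (w.1.adicCompletion L)) ∈ iwahoriGL 2 (w.1.adicCompletion L))
    {γ : ((cmDatum L 2 (Matrix.of fun i j : Fin 2 => if i.val + j.val + 1 = 2 then (1 : L) else 0)).Local v)} (hreg : IsRegularElt (γ.val : GL (Fin 2) (LocalRing L v)))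
    {d : Fin 2 → (LocalRing L v)ˣ} (hd : glDiagonal 2 (LocalRing L v) d = (γ.val : GL (Fin 2) (LocalRing L v)))
    (hb : IsUnit ((((d 0)⁻¹ * d 1 : (LocalRing L v)ˣ) : LocalRing L v) - 1)) :
    (((ν I).toReal : ℂ))⁻¹ * classOrbitalIntegral m ((I : Set ((cmDatum L 2 (Matrix.of fun i j : Fin 2 => if i.val + j.val + 1 = 2 then (1 : L) else 0)).Local v)).indicator fun _ => (1 : ℂ)) (ConjClasses.mk γ) =
      2 * (((ν (cmLocalIntegralLevel L 2 (Matrix.of fun i j : Fin 2 => if i.val + j.val + 1 = 2 then (1 : L) else 0) v)).toReal : ℂ))⁻¹ *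
        classOrbitalIntegral m (((cmLocalIntegralLevel L 2 (Matrix.of fun i j : Fin 2 => if i.val + j.val + 1 = 2 then (1 : L) else 0) v) : Set ((cmDatum L 2 (Matrix.of fun i j : Fin 2 => if i.val + j.val + 1 = 2 then (1 : L) else 0)).Local v)).indicator fun _ => (1 : ℂ)) (ConjClasses.mk γ) :=
  inv_measure_mul_classOrbitalIntegral_iwahori_eq_two_mul_of_torus_regular L w hw ν hm I hIo
    (mem_iff_mem_cmLocalIntegralLevel_and_v_lt_one_of_mem_iff_iwahoriGL L w hw I hIw) hreg hd hb

end IwahoriToken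


end Literature.NumberTheory.Automorphic.UnitaryGroup

end
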